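import Summits.ResolutionOfSingularities.ResolutionOfSingularities.Theorems.PurelyInseparableDim4PureLeafOneOdd
import HarnessLib
import HarnessLib.Audit.Tags

/-!
# Purely inseparable fourfolds — PARITY BOOKKEEPING of the pure-leaf class over `𝔽₂`
# (cell res-dim4-pi; D3b (R3) of `HOME/res-dim4-p-10/D3b-PAPER.md` §3–§4: the invariants)
# [OURS · counted 0 · exponent arithmetic of OUR frame, not about resolution]

Width seat `res-dim4-p-10` (g3).  The invariant class of the paper proof «every pure leaf wins the plain GLOBAL game
over `𝔽₂`» consists of PRODUCT states `N(a,e) = ∏ xᵢ^{aᵢ}(1+xᵢ)^{eᵢ}` satisfying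
* (I5) `eᵢ` odd ⇒ `aᵢ = 0` (a «type-B» variable carries no power of `xᵢ`; it implies (I1): no `(odd, odd)` pair), and
* (I6) `aᵢ` odd and `eᵢ > 0` (a «mixed type-A» variable) ⇒ every other variable has `a`, `e` both even («type C»),
and of L-STATES `N(a,e)·(∏_{i∈T}(1+xᵢ) + 1)` with all `aᵢ, eᵢ` even and `aᵢ = 0` on `T`.  This file is the pure
exponent arithmetic (no polynomials) of the closure of that class under one move: the chart (`a_j ↦ a_j − 2`, resp.
`a_j ↦ 0` for the pair move), the `𝔽₂`-translation = SWAP `(aᵢ,eᵢ) ↦ (eᵢ,aᵢ)` on the translated set, and the two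
cleaning outcomes — (α) a purely odd factor survives: the swapped pair is again in the class
(`classU_swap_of_purelyOdd`); (β) no purely odd factor: all `a′` are even, and if at least two `e′ᵢ` are odd then
`a′ᵢ = 0` at every odd `e′ᵢ` (`classU_swap_of_forall`) — plus the successor classes after the cleaning
(`classU_add_indicator`, `classU_L_exit`) and the measure identities (`Σ (aᵢ+eᵢ)`, `+ |T|` for L-states).

Nothing here proves resolution of singularities in dimension ≥ 4 / characteristic `p`; counted 0; AI work, weaker than
expert review. bears_on: LADDER-RESOLUTION:D157-DOOR2 (res-dim4-pi · WORD #60 D3b (R3)). Supports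
stmt-ResolutionOfSingularities-16155 (helper).
-/

set_option linter.dupNamespace false

open Finset

open scoped BigOperators

namespace Summit.ResolutionOfSingularities.ResolutionOfSingularities.Theorems.PIDim4

namespace PureLeafNF

/-! ## 1. The swap of a class pair -/

/-- **(α) The swapped pair stays in the class when an odd `a′` survives.** If `(a,e)` satisfies (I5), (I6)
and the swap `(a′,e′)` along `b` has some `k` with `a′_k` odd (e.g. a purely odd factor), then `(a′,e′)` satisfies
(I5), (I6). [folklore] -/
theorem classU_swap_of_purelyOdd (a e : Fin 4 → ℕ) (hI5 : ∀ i, e i % 2 = 1 → a i = 0)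
    (hI6 : ∀ i, a i % 2 = 1 → 0 < e i → ∀ i', i' ≠ i → a i' % 2 = 0 ∧ e i' % 2 = 0)
    (b : Fin 4 → ZMod 2) {k : Fin 4} (hak : (if b k = 0 then a k else e k) % 2 = 1) :
    (∀ i, (if b i = 0 then e i else a i) % 2 = 1 → (if b i = 0 then a i else e i) = 0) ∧
      (∀ i, (if b i = 0 then a i else e i) % 2 = 1 → 0 < (if b i = 0 then e i else a i) →
        ∀ i', i' ≠ i → (if b i' = 0 then a i' else e i') % 2 = 0 ∧ (if b i' = 0 then e i' else a i') % 2 = 0) := by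
  refine ⟨fun i hi => ?_, fun i hai hei i' hi' => ?_⟩
  · by_cases hb : b i = 0
    · rw [if_pos hb] at hi ⊢; exact hI5 i hi
    · rw [if_neg hb] at hi ⊢
      -- `e′ᵢ = aᵢ` odd, `a′ᵢ = eᵢ` is even by (I5); if `eᵢ > 0` the variable `i` was mixed, so everything else is
      -- of type C and no purely odd factor could survive
      by_contra hne
      have hC := hI6 i hi (Nat.pos_of_ne_zero hne)
      by_cases hki : k = i
      · subst hki
        rw [if_neg hb] at hak
        have := hI5 k (by omega : e k % 2 = 1)
        omega
      · obtain ⟨h1, h2⟩ := hC k hki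
        by_cases hbk : b k = 0
        · rw [if_pos hbk] at hak; omega
        · rw [if_neg hbk] at hak; omega
  · by_cases hb : b i = 0
    · rw [if_pos hb] at hai hei
      obtain ⟨h1, h2⟩ := hI6 i hai hei i' hi'
      by_cases hb' : b i' = 0
      · rw [if_pos hb', if_pos hb']; exact ⟨h1, h2⟩
      · rw [if_neg hb', if_neg hb']; exact ⟨h2, h1⟩
    · rw [if_neg hb] at hai hei
      have := hI5 i hai
      omega

/-- **(β) No purely odd factor survives the swap**: then every `a′ᵢ` is even, and if at least two `e′ᵢ` are odd then
`a′ᵢ = 0` wherever `e′ᵢ` is odd (the only exception — a swapped mixed variable — is alone). [folklore] -/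
theorem classU_swap_of_forall (a e : Fin 4 → ℕ) (hI5 : ∀ i, e i % 2 = 1 → a i = 0)
    (hI6 : ∀ i, a i % 2 = 1 → 0 < e i → ∀ i', i' ≠ i → a i' % 2 = 0 ∧ e i' % 2 = 0)
    (b : Fin 4 → ZMod 2)
    (hno : ∀ k, ¬ ((if b k = 0 then a k else e k) % 2 = 1 ∧ (if b k = 0 then e k else a k) % 2 = 0)) :
    (∀ i, (if b i = 0 then a i else e i) % 2 = 0) ∧
      (2 ≤ (Finset.univ.filter fun i => (if b i = 0 then e i else a i) % 2 = 1).card →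
        ∀ i, (if b i = 0 then e i else a i) % 2 = 1 → (if b i = 0 then a i else e i) = 0) := by
  have hI1 : ∀ i, a i % 2 = 1 → e i % 2 = 0 := fun i h => by
    by_contra h'
    have := hI5 i (by omega : e i % 2 = 1)
    omega
  refine ⟨fun i => ?_, fun hcard i hi => ?_⟩
  · by_contra hodd
    have hodd' : (if b i = 0 then a i else e i) % 2 = 1 := by omega
    have heodd : (if b i = 0 then e i else a i) % 2 = 1 := by
      by_contra h
      exact hno i ⟨hodd', by omega⟩
    by_cases hb : b i = 0
    · rw [if_pos hb] at hodd' heodd; have := hI1 i hodd'; omega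
    · rw [if_neg hb] at hodd' heodd; have := hI1 i heodd; omega
  · by_cases hb : b i = 0
    · rw [if_pos hb] at hi ⊢; exact hI5 i hi
    · rw [if_neg hb] at hi ⊢
      by_contra hne
      have hC := hI6 i hi (Nat.pos_of_ne_zero hne)
      -- every other index has even `e′`: the odd-`e′` set is inside `{i}`
      have hsub : (Finset.univ.filter fun i' => (if b i' = 0 then e i' else a i') % 2 = 1) ⊆ {i} := by
        intro i' hi'
        rw [Finset.mem_filter] at hi'
        rw [Finset.mem_singleton]
        by_contra hne'
        obtain ⟨h1, h2⟩ := hC i' hne'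
        have h3 := hi'.2
        by_cases hb' : b i' = 0
        · rw [if_pos hb'] at h3; omega
        · rw [if_neg hb'] at h3; omega
      have := Finset.card_le_card hsub
      rw [Finset.card_singleton] at this
      omega

/-! ## 2. The charts keep the class -/

/-- The singleton chart `a_j ↦ a_j − 2` (`2 ≤ a_j`) keeps (I5), (I6). [folklore] -/
theorem classU_update_sub_two (a e : Fin 4 → ℕ) (hI5 : ∀ i, e i % 2 = 1 → a i = 0)
    (hI6 : ∀ i, a i % 2 = 1 → 0 < e i → ∀ i', i' ≠ i → a i' % 2 = 0 ∧ e i' % 2 = 0) {j : Fin 4}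
    (hj : 2 ≤ a j) :
    (∀ i, e i % 2 = 1 → Function.update a j (a j - 2) i = 0) ∧
      (∀ i, Function.update a j (a j - 2) i % 2 = 1 → 0 < e i →
        ∀ i', i' ≠ i → Function.update a j (a j - 2) i' % 2 = 0 ∧ e i' % 2 = 0) := by
  have hupd : ∀ i, Function.update a j (a j - 2) i % 2 = a i % 2 := fun i => by
    by_cases hij : i = j
    · subst hij; rw [Function.update_self]; omega
    · rw [Function.update_of_ne hij]
  refine ⟨fun i hi => ?_, fun i hai hei i' hi' => ?_⟩
  · by_cases hij : i = j
    · subst hij; have := hI5 i hi; omega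
    · rw [Function.update_of_ne hij]; exact hI5 i hi
  · rw [hupd] at hai
    obtain ⟨h1, h2⟩ := hI6 i hai hei i' hi'
    rw [hupd]
    exact ⟨h1, h2⟩

/-- With two odd `a_j`, `a_k` (`j ≠ k`) no variable is mixed: `aᵢ` odd ⇒ `eᵢ = 0`. [folklore] -/
theorem e_eq_zero_of_two_odd (a e : Fin 4 → ℕ)
    (hI6 : ∀ i, a i % 2 = 1 → 0 < e i → ∀ i', i' ≠ i → a i' % 2 = 0 ∧ e i' % 2 = 0) {j k : Fin 4}
    (hjk : j ≠ k) (haj : a j % 2 = 1) (hak : a k % 2 = 1) : ∀ i, a i % 2 = 1 → e i = 0 := by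
  intro i hi
  by_contra hne
  have hC := hI6 i hi (Nat.pos_of_ne_zero hne)
  by_cases hij : j = i
  · subst hij; have := (hC k hjk.symm).1; omega
  · have := (hC j hij).1; omega

/-- The pair chart `a_j ↦ 0` (`a_j = a_k = 1`, `j ≠ k`) keeps (I5), (I6), and `e_j = e_k = 0`. [folklore] -/
theorem classU_update_zero (a e : Fin 4 → ℕ) (hI5 : ∀ i, e i % 2 = 1 → a i = 0)
    (hI6 : ∀ i, a i % 2 = 1 → 0 < e i → ∀ i', i' ≠ i → a i' % 2 = 0 ∧ e i' % 2 = 0) {j k : Fin 4}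
    (hjk : j ≠ k) (haj : a j = 1) (hak : a k = 1) :
    e j = 0 ∧ e k = 0 ∧ (∀ i, e i % 2 = 1 → Function.update a j 0 i = 0) ∧
      (∀ i, Function.update a j 0 i % 2 = 1 → 0 < e i →
        ∀ i', i' ≠ i → Function.update a j 0 i' % 2 = 0 ∧ e i' % 2 = 0) := by
  have hnomix := e_eq_zero_of_two_odd a e hI6 hjk (by omega) (by omega)
  refine ⟨hnomix j (by omega), hnomix k (by omega), fun i hi => ?_, fun i hai hei i' hi' => ?_⟩
  · by_cases hij : i = j
    · subst hij; rw [Function.update_self]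
    · rw [Function.update_of_ne hij]; exact hI5 i hi
  · exfalso
    by_cases hij : i = j
    · subst hij; rw [Function.update_self] at hai; omega
    · rw [Function.update_of_ne hij] at hai; have := hnomix i hai; omega

/-! ## 3. The successor classes after the cleaning -/

/-- **(β, one odd `e′`)**: if all `aᵢ`, `êᵢ` are even then `(a + δ_k, ê)` satisfies (I5), (I6) (one type-A variable at
`k`, everything else of type C). [folklore] -/
theorem classU_add_indicator (a e : Fin 4 → ℕ) (ha : ∀ i, a i % 2 = 0) (he : ∀ i, e i % 2 = 0) (k : Fin 4) :
    (∀ i, (e i + 0) % 2 = 1 → a i + (if i = k then 1 else 0) = 0) ∧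
      (∀ i, (a i + (if i = k then 1 else 0)) % 2 = 1 → 0 < e i + 0 →
        ∀ i', i' ≠ i → (a i' + (if i' = k then 1 else 0)) % 2 = 0 ∧ (e i' + 0) % 2 = 0) := by
  refine ⟨fun i hi => by have := he i; omega, fun i hai _ i' hi' => ?_⟩
  have hik : i = k := by
    by_contra h
    rw [if_neg h] at hai
    have := ha i
    omega
  subst hik
  rw [if_neg hi']
  exact ⟨by have := ha i'; omega, by have := he i'; omega⟩

/-- The chart-and-swap of an all-even pair with `aᵢ = 0` on `T` (`2 ≤ a_j`): still all even, still `0` on `T`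
(`j ∉ T`). [folklore] -/
theorem classL_chartSwap (a e : Fin 4 → ℕ) (ha : ∀ i, a i % 2 = 0) (he : ∀ i, e i % 2 = 0)
    (T : Finset (Fin 4)) (haT : ∀ i ∈ T, a i = 0) {j : Fin 4} (hj : 2 ≤ a j) (b : Fin 4 → ZMod 2)
    (hT : ∀ i ∈ T, b i = 0) :
    (∀ i, (if b i = 0 then Function.update a j (a j - 2) i else e i) % 2 = 0) ∧
      (∀ i, (if b i = 0 then e i else Function.update a j (a j - 2) i) % 2 = 0) ∧
      ∀ i ∈ T, (if b i = 0 then Function.update a j (a j - 2) i else e i) = 0 := by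
  obtain ⟨h1, h2⟩ := even_chartSwap ha he j b
  refine ⟨h1, h2, fun i hi => ?_⟩
  have hij : i ≠ j := fun h => by have := haT i hi; subst h; omega
  rw [if_pos (hT i hi), Function.update_of_ne hij]
  exact haT i hi

/-- **(L, exit)**: the product successor `N(a″ + 𝟙_{T∩B}, e″ + 𝟙_{T∖B})` of an L-state satisfies (I5), (I6) (pure
type-A variables on `T ∩ B`, type B on `T ∖ B`, type C elsewhere). [folklore] -/
theorem classU_L_exit (a e : Fin 4 → ℕ) (ha : ∀ i, a i % 2 = 0) (he : ∀ i, e i % 2 = 0)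
    (T : Finset (Fin 4)) (haT : ∀ i ∈ T, a i = 0) {j : Fin 4} (hj : 2 ≤ a j) (b : Fin 4 → ZMod 2) :
    (∀ i, ((if b i = 0 then e i else Function.update a j (a j - 2) i) +
          (if i ∈ T.filter (fun i => b i = 0) then 1 else 0)) % 2 = 1 →
        (if b i = 0 then Function.update a j (a j - 2) i else e i) +
          (if i ∈ T.filter (fun i => b i ≠ 0) then 1 else 0) = 0) ∧
      (∀ i, ((if b i = 0 then Function.update a j (a j - 2) i else e i) +
          (if i ∈ T.filter (fun i => b i ≠ 0) then 1 else 0)) % 2 = 1 →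
        0 < (if b i = 0 then e i else Function.update a j (a j - 2) i) +
          (if i ∈ T.filter (fun i => b i = 0) then 1 else 0) →
        ∀ i', i' ≠ i →
          ((if b i' = 0 then Function.update a j (a j - 2) i' else e i') +
            (if i' ∈ T.filter (fun i => b i ≠ 0) then 1 else 0)) % 2 = 0 ∧
          ((if b i' = 0 then e i' else Function.update a j (a j - 2) i') +
            (if i' ∈ T.filter (fun i => b i = 0) then 1 else 0)) % 2 = 0) := by
  obtain ⟨h1, h2⟩ := even_chartSwap ha he j b
  have hj' : ∀ i ∈ T, i ≠ j := fun i hi h => by have := haT i hi; subst h; omega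
  refine ⟨fun i hi => ?_, fun i hai hei i' hi' => ?_⟩
  · -- `e₁ᵢ` odd forces `i ∈ T`, `bᵢ = 0`; then `a₁ᵢ = aᵢ = 0`
    have hiT : i ∈ T.filter (fun i => b i = 0) := by
      by_contra h; rw [if_neg h] at hi; have := h2 i; omega
    obtain ⟨hiT', hb⟩ := Finset.mem_filter.mp hiT
    have hnot : i ∉ T.filter (fun i => b i ≠ 0) := fun h => (Finset.mem_filter.mp h).2 hb
    rw [if_neg hnot, if_pos hb, Function.update_of_ne (hj' i hiT'), add_zero]
    exact haT i hiT'
  · -- `a₁ᵢ` odd forces `i ∈ T`, `bᵢ ≠ 0`; then `e₁ᵢ = aᵢ = 0`, so the variable is not mixed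
    exfalso
    have hiT : i ∈ T.filter (fun i => b i ≠ 0) := by
      by_contra h; rw [if_neg h] at hai; have := h1 i; omega
    obtain ⟨hiT', hb⟩ := Finset.mem_filter.mp hiT
    have hnot : i ∉ T.filter (fun i => b i = 0) := fun h => hb (Finset.mem_filter.mp h).2
    rw [if_neg hnot, if_neg hb, Function.update_of_ne (hj' i hiT'), add_zero, haT i hiT'] at hei
    exact absurd hei (lt_irrefl 0)

/-! ## 4. Measure identities -/

/-- The swap does not change `Σ (aᵢ + eᵢ)`. [folklore] -/
theorem sum_swap (a e : Fin 4 → ℕ) (b : Fin 4 → ZMod 2) :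
    ∑ i, ((if b i = 0 then a i else e i) + (if b i = 0 then e i else a i)) = ∑ i, (a i + e i) :=
  Finset.sum_congr rfl fun i _ => by split_ifs <;> ring

/-- The measure of the pair move: `Σ (a′ + e′) + 1 = Σ (a + e)` for the chart `a_j ↦ 0` (`a_j = 1`) and any swap.
[folklore] -/
theorem sum_pairSwap (a e : Fin 4 → ℕ) {j : Fin 4} (haj : a j = 1) (b : Fin 4 → ZMod 2) :
    (∑ i, ((if b i = 0 then Function.update a j 0 i else e i) +
        (if b i = 0 then e i else Function.update a j 0 i))) + 1 = ∑ i, (a i + e i) := by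
  rw [sum_swap, Finset.sum_add_distrib, Finset.sum_add_distrib]
  have h1 := Finset.add_sum_erase Finset.univ a (Finset.mem_univ j)
  have h2 := Finset.add_sum_erase Finset.univ (Function.update a j 0) (Finset.mem_univ j)
  have hrest : ∑ i ∈ Finset.univ.erase j, Function.update a j 0 i = ∑ i ∈ Finset.univ.erase j, a i :=
    Finset.sum_congr rfl fun i hi => by rw [Function.update_of_ne (Finset.ne_of_mem_erase hi)]
  rw [Function.update_self] at h2
  omega

/-- `Σ eᵢ % 2 = |{i : eᵢ odd}|`. [folklore] -/
theorem sum_mod_two_eq_card (e : Fin 4 → ℕ) :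
    ∑ i, e i % 2 = (Finset.univ.filter fun i => e i % 2 = 1).card := by
  rw [Finset.card_filter]
  exact Finset.sum_congr rfl fun i _ => by
    rcases Nat.mod_two_eq_zero_or_one (e i) with h | h
    · rw [h, if_neg (by omega)]
    · rw [h, if_pos rfl]

/-- **Measure of an L-birth**: `Σ êᵢ + |{i : e′ᵢ odd}| = Σ e′ᵢ` (`êᵢ = e′ᵢ − e′ᵢ % 2`). [folklore] -/
theorem sum_sub_mod_add_card (e : Fin 4 → ℕ) :
    (∑ i, (e i - e i % 2)) + (Finset.univ.filter fun i => e i % 2 = 1).card = ∑ i, e i := by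
  rw [← sum_mod_two_eq_card, ← Finset.sum_add_distrib]
  exact Finset.sum_congr rfl fun i _ => Nat.sub_add_cancel (Nat.mod_le _ _)

/-- `Σᵢ 𝟙[i ∈ A] = |A|`. [folklore] -/
theorem sum_indicator_eq_card (A : Finset (Fin 4)) : ∑ i, (if i ∈ A then 1 else 0 : ℕ) = A.card := by
  rw [Finset.sum_boole, Finset.filter_mem_eq_inter, Finset.univ_inter]; rfl

/-- **Measure of an L-exit**: `Σ (a₁ + e₁) + 2 = Σ (a + e) + |T|` for the product successor of an L-state.
[folklore] -/
theorem sum_L_exit (a e : Fin 4 → ℕ) (T : Finset (Fin 4)) {j : Fin 4} (hj : 2 ≤ a j) (b : Fin 4 → ZMod 2) :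
    (∑ i, (((if b i = 0 then Function.update a j (a j - 2) i else e i) +
          (if i ∈ T.filter (fun i => b i ≠ 0) then 1 else 0)) +
        ((if b i = 0 then e i else Function.update a j (a j - 2) i) +
          (if i ∈ T.filter (fun i => b i = 0) then 1 else 0)))) + 2 =
      (∑ i, (a i + e i)) + T.card := by
  have hsw := sum_chartSwap a e hj b
  have hsplit : ∀ i, (((if b i = 0 then Function.update a j (a j - 2) i else e i) +
          (if i ∈ T.filter (fun i => b i ≠ 0) then 1 else 0)) +
        ((if b i = 0 then e i else Function.update a j (a j - 2) i) +
          (if i ∈ T.filter (fun i => b i = 0) then 1 else 0))) =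
      ((if b i = 0 then Function.update a j (a j - 2) i else e i) +
          (if b i = 0 then e i else Function.update a j (a j - 2) i)) +
        ((if i ∈ T.filter (fun i => b i ≠ 0) then 1 else 0) +
          (if i ∈ T.filter (fun i => b i = 0) then 1 else 0)) := fun i => by ring
  simp_rw [hsplit]
  have hind : ∑ i, ((if i ∈ T.filter (fun i => b i ≠ 0) then 1 else 0 : ℕ) +
      (if i ∈ T.filter (fun i => b i = 0) then 1 else 0 : ℕ)) =
      (T.filter (fun i => b i ≠ 0)).card + (T.filter (fun i => b i = 0)).card := by
    rw [Finset.sum_add_distrib, sum_indicator_eq_card, sum_indicator_eq_card]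
  rw [Finset.sum_add_distrib, hind]
  have hcard : (T.filter (fun i => b i ≠ 0)).card + (T.filter (fun i => b i = 0)).card = T.card := by
    have h := Finset.card_filter_add_card_filter_not (s := T) (fun i => b i ≠ 0)
    have hf : T.filter (fun i => ¬ b i ≠ 0) = T.filter (fun i => b i = 0) :=
      Finset.filter_congr fun i _ => not_ne_iff
    rwa [hf] at h
  omega

end PureLeafNF

end Summit.ResolutionOfSingularities.ResolutionOfSingularities.Theorems.PIDim4
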